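import Literature.RingTheory.FormalGroups.HondaTypeTransport
import HarnessLib

/-!
# Hazewinkel's functional equation lemma (ii) for the Honda type `p − aT + T²`:
# `ℓ₁⁻¹ ∘ ℓ₂` is integral when `ℓ₁`, `ℓ₂` have the same type (proofs only)

Topic `RingTheory/FormalGroups` (theorems only; no definitions, no named facts). Sequel of
`HondaTypeTransport.lean`, which proves parts (iii) (transport, `norm_coeff_hondaShift_subst_le_one`)
and (iv) of the functional equation lemma for `hondaShift p a ℓ = ℓ − (a/p)ℓ(Xᵖ) + (1/p)ℓ(X^{p²})`.
Here is part (ii), in the inverse-free form in which it is used: if `ℓ` is of type `p − aT + T²`,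
`[X¹]ℓ` is a unit of `ℤ_p`, `ψ ∈ Xℚ_p⟦X⟧`, and `ℓ ∘ ψ` is again of type `p − aT + T²`, then `ψ` has
`p`-integral coefficients (`norm_coeff_le_one_of_hondaShift_subst`). With `ℓ = log_F` and
`ℓ ∘ ψ = Σ aₙXⁿ/n` this is Honda's theorem that two formal groups over `ℤ_p` of the same type are
strongly isomorphic over `ℤ_p` (Honda 1970, Thm. 2), e.g. `exp_F ∘ ℓ ∈ ℤ_p⟦X⟧` for the
`L`-series logarithm `ℓ` of an elliptic curve at a good prime — the input "Honda for `W'` alone" of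
the finite-height route recorded in `NumberTheory/EllipticCurves/NeronIsogenyScaling.lean`.

## The argument (Hazewinkel 1978, I.2.3, proof of (ii))

Induction on `n`: if the coefficients of `ψ` below `n` are integral, put `ψₙ = trunc n ψ ∈ ℤ_p[X]`.
By (iii) `ℓ ∘ ψₙ` is of type `p − aT + T²`, hence so is `D = ℓ ∘ ψ − ℓ ∘ ψₙ`; as `ψ ≡ ψₙ (mod Xⁿ)`,
`D ≡ [X¹]ℓ · [Xⁿ]ψ · Xⁿ (mod X^{n+1})` (`coeff_subst_sub_subst_eq_zero_of_X_pow_dvd_sub`,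
`coeff_subst_sub_subst_eq_of_X_pow_dvd_sub`), so the coefficient of `Xⁿ` of `hondaShift p a D`,
which is integral, is `[X¹]ℓ · [Xⁿ]ψ` (the shifted terms see only coefficients of `D` of index
`n/p, n/p² < n`, which vanish).

## Sources

* M. Hazewinkel, *Formal Groups and Applications* (1978), Ch. I §2.2 (ii) and §2.3. [Hazewinkel1978]
* T. Honda, *On the theory of commutative formal groups*, J. Math. Soc. Japan 22 (1970), Thm. 2
  (p. 223), Lemma 2.4. [Honda1970]
-/

noncomputable section

open PowerSeries

namespace Literature.RingTheory.FormalGroups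

variable {p : ℕ} [hp : Fact p.Prime]

/-! ### Congruences for substitution of congruent arguments -/

section Congr

/-- `X ∣ ψᵏ` for `ψ(0) = 0` and `k ≥ 1`. [folklore] -/
theorem X_dvd_pow_of_constantCoeff_eq_zero {R : Type*} [CommRing R] {ψ : R⟦X⟧}
    (hψ : constantCoeff ψ = 0) {k : ℕ} (hk : k ≠ 0) : (X : R⟦X⟧) ∣ ψ ^ k :=
  (X_dvd_iff.mpr hψ).trans (dvd_pow_self ψ hk)

/-- If `ψ ≡ ψ' (mod Xⁿ)` then `ψⁱ ≡ ψ'ⁱ (mod Xⁿ)`. [folklore] -/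
theorem X_pow_dvd_pow_sub_pow {R : Type*} [CommRing R] {ψ ψ' : R⟦X⟧} {n : ℕ}
    (h : (X : R⟦X⟧) ^ n ∣ ψ - ψ') (i : ℕ) : (X : R⟦X⟧) ^ n ∣ ψ ^ i - ψ' ^ i :=
  h.trans (sub_dvd_pow_sub_pow ψ ψ' i)

/-- If `ψ ≡ ψ' (mod Xⁿ)` with `ψ(0) = ψ'(0) = 0` then `ψⁱ ≡ ψ'ⁱ (mod X^{n+1})` for `i ≥ 2`. [folklore] -/
theorem X_pow_succ_dvd_pow_sub_pow {R : Type*} [CommRing R] {ψ ψ' : R⟦X⟧} {n : ℕ}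
    (h : (X : R⟦X⟧) ^ n ∣ ψ - ψ') (hψ : constantCoeff ψ = 0) (hψ' : constantCoeff ψ' = 0)
    {i : ℕ} (hi : 2 ≤ i) : (X : R⟦X⟧) ^ (n + 1) ∣ ψ ^ i - ψ' ^ i := by
  have key : ψ ^ i - ψ' ^ i = (∑ k ∈ Finset.range i, ψ ^ k * ψ' ^ (i - 1 - k)) * (ψ - ψ') :=
    (geom_sum₂_mul ψ ψ' i).symm
  rw [key, pow_succ']
  refine mul_dvd_mul ?_ h
  refine Finset.dvd_sum fun k hk ↦ ?_
  rw [Finset.mem_range] at hk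
  rcases Nat.eq_zero_or_pos k with rfl | hk0
  · rw [pow_zero, one_mul]
    exact X_dvd_pow_of_constantCoeff_eq_zero hψ' (by omega)
  · exact (X_dvd_pow_of_constantCoeff_eq_zero hψ hk0.ne').trans (dvd_mul_right _ _)

/-- **`ℓ(ψ) ≡ ℓ(ψ') (mod Xⁿ)` if `ψ ≡ ψ' (mod Xⁿ)`** (`ψ(0) = ψ'(0) = 0`). [folklore] -/
theorem coeff_subst_sub_subst_eq_zero_of_X_pow_dvd_sub {ψ ψ' : ℚ_[p]⟦X⟧} (ℓ : ℚ_[p]⟦X⟧) {n : ℕ}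
    (h : (X : ℚ_[p]⟦X⟧) ^ n ∣ ψ - ψ') (hψ : constantCoeff ψ = 0) (hψ' : constantCoeff ψ' = 0)
    {m : ℕ} (hm : m < n) : coeff m (ℓ.subst ψ - ℓ.subst ψ') = 0 := by
  rw [map_sub, coeff_subst_eq_sum hψ, coeff_subst_eq_sum hψ', ← Finset.sum_sub_distrib]
  refine Finset.sum_eq_zero fun i _ ↦ ?_
  rw [← mul_sub, ← map_sub, X_pow_dvd_iff.mp (X_pow_dvd_pow_sub_pow h i) m hm, mul_zero]

/-- **The leading difference**: if `ψ ≡ ψ' (mod Xⁿ)` (`ψ(0) = ψ'(0) = 0`, `n ≥ 1`) then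
`[Xⁿ](ℓ(ψ) − ℓ(ψ')) = [X¹]ℓ · [Xⁿ](ψ − ψ')`. [folklore] -/
theorem coeff_subst_sub_subst_eq_of_X_pow_dvd_sub {ψ ψ' : ℚ_[p]⟦X⟧} (ℓ : ℚ_[p]⟦X⟧) {n : ℕ}
    (hn : 0 < n) (h : (X : ℚ_[p]⟦X⟧) ^ n ∣ ψ - ψ') (hψ : constantCoeff ψ = 0)
    (hψ' : constantCoeff ψ' = 0) :
    coeff n (ℓ.subst ψ - ℓ.subst ψ') = coeff 1 ℓ * coeff n (ψ - ψ') := by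
  rw [map_sub (coeff n), coeff_subst_eq_sum hψ, coeff_subst_eq_sum hψ', ← Finset.sum_sub_distrib]
  rw [Finset.sum_eq_single_of_mem 1 (Finset.mem_range.mpr (by omega))]
  · rw [pow_one, pow_one, ← mul_sub, ← map_sub]
  · intro i _ hi1
    rw [← mul_sub, ← map_sub]
    rcases Nat.lt_or_gt_of_ne hi1 with hi0 | hi2
    · rw [Nat.lt_one_iff.mp hi0, pow_zero, pow_zero, sub_self, map_zero, mul_zero]
    · rw [X_pow_dvd_iff.mp (X_pow_succ_dvd_pow_sub_pow h hψ hψ' hi2) n n.lt_succ_self, mul_zero]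

end Congr

/-! ### Functional equation lemma (ii) -/

section FEii

/-- `hondaShift` is subtractive. [folklore] -/
theorem hondaShift_sub (a : ℚ_[p]) (ℓ ℓ' : ℚ_[p]⟦X⟧) :
    hondaShift p a (ℓ - ℓ') = hondaShift p a ℓ - hondaShift p a ℓ' := by
  simp only [hondaShift_def, map_sub]; ring

/-- The coefficient of `Xⁿ` of `hondaShift p a D` is `[Xⁿ]D` when the coefficients of `D` below
`n` vanish (`n ≥ 1`): the shifted terms only see `[X^{n/p}]D`, `[X^{n/p²}]D`. [folklore] -/
theorem coeff_hondaShift_eq_coeff_of_forall_lt (a : ℚ_[p]) {D : ℚ_[p]⟦X⟧} {n : ℕ} (hn : 0 < n)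
    (hD : ∀ m < n, coeff m D = 0) : coeff n (hondaShift p a D) = coeff n D := by
  have hp1 : 1 < p := hp.out.one_lt
  rw [coeff_hondaShift]
  have h1 : (if p ∣ n then coeff (n / p) D else 0) = 0 := by
    split_ifs with h
    · exact hD _ (Nat.div_lt_self hn hp1)
    · rfl
  have h2 : (if p ^ 2 ∣ n then coeff (n / p ^ 2) D else 0) = 0 := by
    split_ifs with h
    · exact hD _ (Nat.div_lt_self hn (by nlinarith))
    · rfl
  rw [h1, h2, mul_zero, mul_zero, sub_zero, add_zero]

/-- The truncation `trunc n ψ`, as a power series, is congruent to `ψ` modulo `Xⁿ`. [folklore] -/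
theorem X_pow_dvd_sub_trunc {R : Type*} [CommRing R] (ψ : R⟦X⟧) (n : ℕ) :
    (X : R⟦X⟧) ^ n ∣ ψ - (trunc n ψ : R⟦X⟧) := by
  refine X_pow_dvd_iff.mpr fun m hm ↦ ?_
  rw [map_sub, Polynomial.coeff_coe, coeff_trunc, if_pos hm, sub_self]

/-- **Functional equation lemma (ii), inverse-free form.** Let `ℓ ∈ ℚ_p⟦X⟧` be of Honda type
`p − aT + T²` (`a ∈ ℤ_p`) with `‖[X¹]ℓ‖ = 1`, and let `ψ ∈ Xℚ_p⟦X⟧` be such that `ℓ ∘ ψ` is again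
of type `p − aT + T²`. Then `ψ ∈ ℤ_p⟦X⟧`. (Hazewinkel's (ii): `ψ = ℓ⁻¹ ∘ ℓ₂` for `ℓ₂ = ℓ ∘ ψ` of the
same type; Honda 1970, Thm. 2: formal groups over `ℤ_p` with the same type are strongly isomorphic
over `ℤ_p`.) [cite: Honda1970, Thm. 2 (p. 223)] -/
theorem norm_coeff_le_one_of_hondaShift_subst {a : ℚ_[p]} (ha : ‖a‖ ≤ 1) {ℓ : ℚ_[p]⟦X⟧}
    (hT : ∀ n, ‖coeff n (hondaShift p a ℓ)‖ ≤ 1) (h1 : ‖coeff 1 ℓ‖ = 1) {ψ : ℚ_[p]⟦X⟧}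
    (hψ0 : constantCoeff ψ = 0) (hTψ : ∀ n, ‖coeff n (hondaShift p a (ℓ.subst ψ))‖ ≤ 1) (n : ℕ) :
    ‖coeff n ψ‖ ≤ 1 := by
  induction n using Nat.strong_induction_on with
  | _ n ih =>
    rcases Nat.eq_zero_or_pos n with rfl | hn
    · rw [coeff_zero_eq_constantCoeff_apply, hψ0, norm_zero]; exact zero_le_one
    -- the integral truncation `ψₙ` and the difference `D = ℓ(ψ) − ℓ(ψₙ)`
    set ψn : ℚ_[p]⟦X⟧ := (trunc n ψ : ℚ_[p]⟦X⟧) with hψn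
    have hψn0 : constantCoeff ψn = 0 := by
      rw [hψn, ← coeff_zero_eq_constantCoeff_apply, Polynomial.coeff_coe, coeff_trunc, if_pos hn,
        coeff_zero_eq_constantCoeff_apply, hψ0]
    have hψnint : ∀ m, ‖coeff m ψn‖ ≤ 1 := fun m ↦ by
      rw [hψn, Polynomial.coeff_coe, coeff_trunc]
      split_ifs with hm
      · exact ih m hm
      · rw [norm_zero]; exact zero_le_one
    have hdvd : (X : ℚ_[p]⟦X⟧) ^ n ∣ ψ - ψn := X_pow_dvd_sub_trunc ψ n
    set D := ℓ.subst ψ - ℓ.subst ψn with hD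
    have hDT : ∀ m, ‖coeff m (hondaShift p a D)‖ ≤ 1 := fun m ↦ by
      rw [hD, hondaShift_sub, map_sub]
      exact norm_coeff_sub_le (hTψ) (norm_coeff_hondaShift_subst_le_one ha hT hψn0 hψnint) m
    have hDlow : ∀ m < n, coeff m D = 0 := fun m hm ↦
      coeff_subst_sub_subst_eq_zero_of_X_pow_dvd_sub ℓ hdvd hψ0 hψn0 hm
    have hDn : coeff n D = coeff 1 ℓ * coeff n ψ := by
      rw [hD, coeff_subst_sub_subst_eq_of_X_pow_dvd_sub ℓ hn hdvd hψ0 hψn0, map_sub,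
        hψn, Polynomial.coeff_coe, coeff_trunc, if_neg (lt_irrefl n), sub_zero]
    have := hDT n
    rw [coeff_hondaShift_eq_coeff_of_forall_lt a hn hDlow, hDn, norm_mul, h1, one_mul] at this
    exact this

/-- **Honda's Theorem 2 for the type `p − aT + T²` (strong isomorphism over `ℤ_p`)**, in the form
used for elliptic curves: if `ℓ₁, ℓ₂ ∈ ℚ_p⟦X⟧` are both of type `p − aT + T²`, `‖[X¹]ℓ₁‖ = 1`, and
`ψ ∈ Xℚ_p⟦X⟧` satisfies `ℓ₁ ∘ ψ = ℓ₂` (so `ψ = ℓ₁⁻¹ ∘ ℓ₂`, e.g. `ψ = exp_F ∘ ℓ₂` for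
`ℓ₁ = log_F`), then `ψ ∈ ℤ_p⟦X⟧`. [cite: Honda1970, Thm. 2 (p. 223)] -/
theorem norm_coeff_le_one_of_subst_eq {a : ℚ_[p]} (ha : ‖a‖ ≤ 1) {ℓ₁ ℓ₂ : ℚ_[p]⟦X⟧}
    (hT₁ : ∀ n, ‖coeff n (hondaShift p a ℓ₁)‖ ≤ 1) (hT₂ : ∀ n, ‖coeff n (hondaShift p a ℓ₂)‖ ≤ 1)
    (h1 : ‖coeff 1 ℓ₁‖ = 1) {ψ : ℚ_[p]⟦X⟧} (hψ0 : constantCoeff ψ = 0) (hψ : ℓ₁.subst ψ = ℓ₂)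
    (n : ℕ) : ‖coeff n ψ‖ ≤ 1 :=
  norm_coeff_le_one_of_hondaShift_subst ha hT₁ h1 hψ0 (fun m ↦ hψ ▸ hT₂ m) n

end FEii

end Literature.RingTheory.FormalGroups
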